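import Literature.MathematicalPhysics.QuantumFieldTheory.TorusChartCurlBound
import HarnessLib

/-!
# Route `BalabanIR`, crux `BirComplexStableXYR` (item `stmt-HubbardSuperconductivity-14845`),
# line `fat-gaussian-defect-calculus`: stub V1 `stub_curlNormBound`

Helper (`--supports`) for the crux
`Summit.HubbardSuperconductivity.HubbardSuperconductivity.Theses.BalabanIR.BirComplexStableXYR`,
line `fat-gaussian-defect-calculus` (lead skeleton `Cruxes/BirComplexStableXYR/Lines/fat_gaussian_defect_calculus.lean`),
stub V1 `stub_curlNormBound` (curl-norm bound; chapter 1 = exact Fröhlich–Spencer unfolding, where it turns the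
coercivity of the thin Gaussian form in `‖σ‖²` into a cost per vortex plaquette).

**Statement.** On a charted torus `F : TorusChart Λ d` (finite site group `Λ`, `d` directions, unit translations
`e_i = F.gen i`) the plaquette circulations `d₁ ω (x; i, j) = ω (x, i) + ω (x + e_i, j) − ω (x + e_j, i) − ω (x, j)` of a
real `1`-cochain `ω` are controlled by its `ℓ²` norm:

  `Σ_{x,i,j} (d₁ ω (x; i, j))² ≤ 16 d · Σ_{x,i} ω (x, i)²`.

**Proof.** This is the Literature theorem `Literature.MathematicalPhysics.QuantumFieldTheory.TorusChart.sum_d₁_sq_le`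
(`Literature/MathematicalPhysics/QuantumFieldTheory/TorusChartCurlBound.lean`: pointwise Cauchy–Schwarz
`(p + q − r − s)² ≤ 4 (p² + q² + r² + s²)` on the four edges of a plaquette, summed over `(x, i, j)`; each of the four
resulting triple sums of squares equals `d · Σ_{x,i} ω (x, i)²`, the translated ones because `x ↦ x + e_i` is a bijection
of the finite group `Λ`), restated verbatim in the registered signature (`Λ : Type`, explicit `d`).  No definition and
no named fact is introduced; sorry-free.
-/

set_option linter.dupNamespace false -- summit = problem name (single-conjunct summit), D-0017

namespace Summit.HubbardSuperconductivity.HubbardSuperconductivity.Theorems.FSUnfolding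

open scoped BigOperators
open Literature.MathematicalPhysics.QuantumFieldTheory

/-- **Stub V1 `stub_curlNormBound` (registered signature, verbatim): curl-norm bound.**  On a charted torus with `d`
directions the plaquette circulations of a real `1`-cochain are controlled by its `ℓ²` norm:
`Σ_{x,i,j} (d₁ω)(x,i,j)² ≤ 16 d · Σ_{x,i} ω(x,i)²` (each circulation is a signed sum of four edge values,
`(Σ₄)² ≤ 4 Σ₄ (·)²`, and `x ↦ x + e_i` is a bijection of the site group).  Proof: the Literature theorem
`TorusChart.sum_d₁_sq_le`. [folklore] -/
theorem stub_curlNormBound :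
    ∀ (Λ : Type) [AddCommGroup Λ] [Fintype Λ] (d : ℕ) (F : TorusChart Λ d) (ω : Λ → Fin d → ℝ),
      ∑ x : Λ, ∑ i : Fin d, ∑ j : Fin d, (F.d₁ ω x i j) ^ 2 ≤ 16 * (d : ℝ) * ∑ x : Λ, ∑ i : Fin d, (ω x i) ^ 2 :=
  fun _ _ _ _ F ω => F.sum_d₁_sq_le ω

end Summit.HubbardSuperconductivity.HubbardSuperconductivity.Theorems.FSUnfolding
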